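import Literature.NumberTheory.LFunctions.WeilCombPairDifference

/-!
# Crux `SignCone.ConeMagnification` (stmt-RiemannHypothesis-16303), line `Sketch` r9, stub `stub_combType` — assembly, part 5:
# the pair difference from ARBITRARY per-node bounds (node → pair summation against `c` and `Λ`)

Generic version of the summation step of the lead's `Literature.NumberTheory.LFunctions.pair_difference_bound`
(`Literature/NumberTheory/LFunctions/WeilCombPairDifference.lean`): if at every node `1 ≤ n ≤ N` the node weight `V(n)` of the pair
`(ℓ, ℓ')` of the `ζ`-mollified comb satisfies
`|V(n) − B(0)(√ℓ/√ℓ')·D(n)/n − hβ(√ℓ'/√ℓ)·Nn(n) − S(gcd(nℓ',ℓ))/n| ≤ err(n)` (the main terms of `node_weight_pair`, an ARBITRARY class term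
`S` and an ARBITRARY error `err`), then for a weight `c ≥ 0` with `Σ_{n ≤ N'} c(n) ≤ A₁N'` and `|Σ_{n ≤ N'} (c−Λ)(n)/n| ≤ T₀`:

  `|E_c − E_Λ − Σ_{n ≤ N} (c−Λ)(n)·(B(0)(√ℓ/√ℓ')D(n)/n + S(gcd(nℓ',ℓ))/n)| ≤ Σ_{n ≤ N} (c+Λ)(n)·err(n) + 8N₀Lh·M·((2T₀+3A')L + T₀ + A')`

(`A' = A₁ + log 4 + 4`): the smooth main terms cancel up to `O(hM)` by `WeilCombDifferenceSums`, exactly as in `pair_difference_bound`.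
This is the shape of the pair-level assembly interface `CombType.combType_of_pairData` (`…CombTypeOfPairData`); the sharp per-node lemma
of the lead's wave 3 supplies `S` and an `err` with `Σ (c+Λ) err = o(log M)`.

* `CombType.pair_difference_of_node_bounds` — the statement above.
-/

noncomputable section

-- `Summit.RiemannHypothesis.RiemannHypothesis.…` repeats a namespace component by design (D-0017 layout).
set_option linter.dupNamespace false

open scoped BigOperators ArithmeticFunction.vonMangoldt
open MeasureTheory Set

namespace Summit.RiemannHypothesis.RiemannHypothesis.Theorems.SignConeConeMagnification

open Literature.NumberTheory.LFunctions

namespace CombType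

/-- Per-node bookkeeping: `cV − ΛV − (c−Λ)(P + Q) = (c−Λ)·Z + (c−Λ)·(V − P − Z − Q)`. [folklore] -/
theorem node_split (cn Ln V P Z Q : ℝ) :
    cn * V - Ln * V - (cn - Ln) * (P + Q) = (cn - Ln) * Z + (cn - Ln) * (V - P - Z - Q) := by ring

/-- **The pair difference from per-node bounds.**  See the module docstring. [folklore] -/
theorem pair_difference_of_node_bounds {B : ℝ → ℝ} {N₀ h A₁ T₀ : ℝ} {L ℓ ℓ' M N : ℕ} {c : ℕ → ℝ}
    (h0 : ∀ x, |B x| ≤ N₀) (hBs : ∀ x, 2 < |x| → B x = 0) (hB0 : ∀ x, 0 ≤ B x)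
    (hL : 1 ≤ L) (hℓ : 1 ≤ ℓ) (hℓL : ℓ ≤ L) (hℓ' : 1 ≤ ℓ') (hℓ'L : ℓ' ≤ L)
    (hh : 0 < h) (hhL : h ≤ 1 / (32 * L)) (hhM : 1 ≤ h * M)
    (hc0 : ∀ n, 0 ≤ c n) (hA₁ : ∀ N : ℕ, 1 ≤ N → ∑ n ∈ Finset.Icc 1 N, c n ≤ A₁ * N)
    (hT : ∀ N : ℕ, |∑ n ∈ Finset.Icc 1 N, (c n - Λ n) / n| ≤ T₀) (hN : 1 ≤ N)
    (S err : ℕ → ℝ)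
    (hnode : ∀ n ∈ Finset.Icc 1 N,
      |(∑ k' ∈ Finset.Icc 1 M,
          (∑ k ∈ Finset.Icc 1 M, B ((Real.log ((n : ℝ) * ℓ' * k' / ℓ) - Real.log k) / h) / Real.sqrt k)
            / Real.sqrt k' / Real.sqrt n)
        - B 0 * (Real.sqrt ℓ / Real.sqrt ℓ') *
            (∑ k' ∈ Finset.Icc 1 ⌊1 / (4 * h) / ((n : ℝ) * ℓ')⌋₊,
              (if ℓ ∣ n * ℓ' * k' then 1 / (k' : ℝ) else 0)) / n
        - h * (∫ v, B v * Real.exp (-(h * v) / 2)) * (Real.sqrt ℓ' / Real.sqrt ℓ) *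
            ((min M ⌊(ℓ : ℝ) * M * Real.exp (-(2 * h)) / (ℓ' * n)⌋₊
                - ⌊1 / (4 * h) / ((n : ℝ) * ℓ')⌋₊ : ℕ) : ℝ)
        - S (Nat.gcd (n * ℓ') ℓ) / n| ≤ err n) :
    |(∑ n ∈ Finset.Icc 1 N, c n *
        (∑ k' ∈ Finset.Icc 1 M,
          (∑ k ∈ Finset.Icc 1 M, B ((Real.log ((n : ℝ) * ℓ' * k' / ℓ) - Real.log k) / h) / Real.sqrt k)
            / Real.sqrt k' / Real.sqrt n))
      - (∑ n ∈ Finset.Icc 1 N, (Λ n : ℝ) *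
        (∑ k' ∈ Finset.Icc 1 M,
          (∑ k ∈ Finset.Icc 1 M, B ((Real.log ((n : ℝ) * ℓ' * k' / ℓ) - Real.log k) / h) / Real.sqrt k)
            / Real.sqrt k' / Real.sqrt n))
      - ∑ n ∈ Finset.Icc 1 N, (c n - Λ n) *
          (B 0 * (Real.sqrt ℓ / Real.sqrt ℓ') *
              (∑ k' ∈ Finset.Icc 1 ⌊1 / (4 * h) / ((n : ℝ) * ℓ')⌋₊,
                (if ℓ ∣ n * ℓ' * k' then 1 / (k' : ℝ) else 0)) / n
            + S (Nat.gcd (n * ℓ') ℓ) / n)|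
      ≤ (∑ n ∈ Finset.Icc 1 N, (c n + Λ n) * err n)
        + 8 * N₀ * L * h * M * ((2 * T₀ + 3 * (A₁ + (Real.log 4 + 4))) * L + (T₀ + (A₁ + (Real.log 4 + 4)))) := by
  have hN₀ : 0 ≤ N₀ := (abs_nonneg _).trans (h0 0)
  have hLR : (1 : ℝ) ≤ L := by exact_mod_cast hL
  have hℓR : (1 : ℝ) ≤ ℓ := by exact_mod_cast hℓ
  have hℓLR : (ℓ : ℝ) ≤ L := by exact_mod_cast hℓL
  have hℓ'R : (1 : ℝ) ≤ ℓ' := by exact_mod_cast hℓ'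
  have hℓ'LR : (ℓ' : ℝ) ≤ L := by exact_mod_cast hℓ'L
  have h32 : 1 / (32 * (L : ℝ)) ≤ 1 / 32 := one_div_le_one_div_of_le (by norm_num) (by linarith)
  have hh4 : h ≤ 1 / 4 := by linarith
  obtain ⟨hT0, hA'0⟩ := diff_consts_nonneg hT (sum_abs_sub_vonMangoldt_le hc0 hA₁)
  set AΛ : ℝ := Real.log 4 + 4 with hAΛ
  set A' : ℝ := A₁ + AΛ with hA'
  -- notation
  set V : ℕ → ℝ := fun n ↦ ∑ k' ∈ Finset.Icc 1 M,
    (∑ k ∈ Finset.Icc 1 M, B ((Real.log ((n : ℝ) * ℓ' * k' / ℓ) - Real.log k) / h) / Real.sqrt k)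
      / Real.sqrt k' / Real.sqrt n with hV
  set D : ℕ → ℝ := fun n ↦ ∑ k' ∈ Finset.Icc 1 ⌊1 / (4 * h) / ((n : ℝ) * ℓ')⌋₊,
    (if ℓ ∣ n * ℓ' * k' then 1 / (k' : ℝ) else 0) with hD
  set Nn : ℕ → ℝ := fun n ↦ ((min M ⌊(ℓ : ℝ) * M * Real.exp (-(2 * h)) / (ℓ' * n)⌋₊
    - ⌊1 / (4 * h) / ((n : ℝ) * ℓ')⌋₊ : ℕ) : ℝ) with hNn
  set mS : ℝ := B 0 * (Real.sqrt ℓ / Real.sqrt ℓ') with hmS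
  set β : ℝ := ∫ v, B v * Real.exp (-(h * v) / 2) with hβ
  set mD : ℝ := h * β * (Real.sqrt ℓ' / Real.sqrt ℓ) with hmD
  -- the per-node split
  have hsplit : (∑ n ∈ Finset.Icc 1 N, c n * V n) - (∑ n ∈ Finset.Icc 1 N, (Λ n : ℝ) * V n)
      - ∑ n ∈ Finset.Icc 1 N, (c n - Λ n) * (mS * D n / n + S (Nat.gcd (n * ℓ') ℓ) / n)
      = mD * ∑ n ∈ Finset.Icc 1 N, (c n - Λ n) * Nn n
        + ∑ n ∈ Finset.Icc 1 N, (c n - Λ n) * (V n - mS * D n / n - mD * Nn n - S (Nat.gcd (n * ℓ') ℓ) / n) := by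
    rw [Finset.mul_sum, ← Finset.sum_sub_distrib, ← Finset.sum_sub_distrib, ← Finset.sum_add_distrib]
    refine Finset.sum_congr rfl fun n _ ↦ ?_
    rw [node_split (c n) (Λ n) (V n) (mS * D n / n) (mD * Nn n) (S (Nat.gcd (n * ℓ') ℓ) / n)]
    ring
  -- the error sum
  have herr : |∑ n ∈ Finset.Icc 1 N, (c n - Λ n) * (V n - mS * D n / n - mD * Nn n - S (Nat.gcd (n * ℓ') ℓ) / n)|
      ≤ ∑ n ∈ Finset.Icc 1 N, (c n + Λ n) * err n := by
    refine (Finset.abs_sum_le_sum_abs _ _).trans (Finset.sum_le_sum fun n hn ↦ ?_)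
    have hb := hnode n hn
    have hb' : |V n - mS * D n / n - mD * Nn n - S (Nat.gcd (n * ℓ') ℓ) / n| ≤ err n := by
      have e : V n - mS * D n / n - mD * Nn n - S (Nat.gcd (n * ℓ') ℓ) / n
          = V n - mS * D n / n - mD * Nn n - S (Nat.gcd (n * ℓ') ℓ) / n := rfl
      simpa only [hV, hD, hNn, hmS, hmD, hβ, mul_div_assoc] using hb
    have hcΛ : |c n - Λ n| ≤ c n + Λ n := by
      have h1 := hc0 n
      have h2 : (0 : ℝ) ≤ Λ n := ArithmeticFunction.vonMangoldt_nonneg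
      rw [abs_le]; constructor <;> linarith
    rw [abs_mul]
    exact mul_le_mul hcΛ hb' (abs_nonneg _) (by linarith [hc0 n, (ArithmeticFunction.vonMangoldt_nonneg : (0:ℝ) ≤ Λ n)])
  -- the smooth main terms against `c - Λ` (as in `pair_difference_bound`)
  obtain ⟨-, -, -, hYM⟩ := node_ranges (M := M) hℓ hℓ' hN hh hh4 hhM
  set X₁ : ℝ := (ℓ : ℝ) * M * Real.exp (-(2 * h)) / ℓ' with hX₁
  set X₂ : ℝ := 1 / (4 * h) / ℓ' with hX₂
  have hX₁0 : 0 ≤ X₁ := by positivity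
  have hX₂0 : 0 ≤ X₂ := by positivity
  have hM1 : 1 ≤ M := by
    have : (0 : ℝ) < M := by
      by_contra hcon; push Not at hcon
      have : h * M ≤ 0 := mul_nonpos_of_nonneg_of_nonpos hh.le hcon
      linarith
    exact_mod_cast this
  have hNn_eq : ∀ n : ℕ, 1 ≤ n → Nn n = ((min M ⌊X₁ / n⌋₊ : ℕ) : ℝ) - (⌊X₂ / n⌋₊ : ℝ) := by
    intro n hn
    have e1 : (ℓ : ℝ) * M * Real.exp (-(2 * h)) / (ℓ' * n) = X₁ / n := by
      rw [hX₁, div_div]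
    have e2 : 1 / (4 * h) / ((n : ℝ) * ℓ') = X₂ / n := by
      rw [hX₂, div_div (1 / (4 * h)) (ℓ' : ℝ) n, mul_comm (ℓ' : ℝ) n]
    obtain ⟨hle, -, -, -⟩ := node_ranges (M := M) hℓ hℓ' hn hh hh4 hhM
    simp only [hNn]
    rw [Nat.cast_sub hle, e1, e2]
  have hsmooth : |∑ n ∈ Finset.Icc 1 N, (c n - Λ n) * Nn n| ≤ (2 * T₀ + 3 * A') * X₁ + (T₀ + A') * X₂ := by
    have hsplit' : ∑ n ∈ Finset.Icc 1 N, (c n - Λ n) * Nn n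
        = ∑ n ∈ Finset.Icc 1 N, (c n - Λ n) * ((min M ⌊X₁ / n⌋₊ : ℕ) : ℝ)
          - ∑ n ∈ Finset.Icc 1 N, (c n - Λ n) * (⌊X₂ / n⌋₊ : ℝ) := by
      rw [← Finset.sum_sub_distrib]
      refine Finset.sum_congr rfl fun n hn ↦ ?_
      rw [hNn_eq n (Finset.mem_Icc.1 hn).1]; ring
    rw [hsplit']
    have b1 := abs_sum_mul_min_floor_le hT (sum_abs_sub_vonMangoldt_le hc0 hA₁) hX₁0 hM1 N
    have b2 := abs_sum_mul_floor_div_le hT (sum_abs_sub_vonMangoldt_le hc0 hA₁) hX₂0 N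
    exact (abs_sub _ _).trans (add_le_add b1 b2)
  have hX₁le : X₁ ≤ L * M := by
    rw [hX₁, div_le_iff₀ (by positivity)]
    have he : Real.exp (-(2 * h)) ≤ 1 := Real.exp_le_one_iff.2 (by linarith)
    have hM0 : (0 : ℝ) ≤ M := Nat.cast_nonneg M
    calc (ℓ : ℝ) * M * Real.exp (-(2 * h)) ≤ L * M * 1 :=
          mul_le_mul (mul_le_mul_of_nonneg_right hℓLR hM0) he (Real.exp_pos _).le (by positivity)
      _ ≤ L * M * ℓ' := mul_le_mul_of_nonneg_left hℓ'R (by positivity)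
  have hX₂le : X₂ ≤ M := by
    rw [hX₂]
    calc 1 / (4 * h) / ℓ' ≤ 1 / (4 * h) := div_le_self (by positivity) hℓ'R
      _ ≤ M := hYM
  have hβ0 : 0 ≤ β := toothBeta_nonneg hB0 h
  have hβ8 : β ≤ 8 * N₀ := toothBeta_le hB0 h0 hBs hh.le hh4
  have hratio : Real.sqrt ℓ' / Real.sqrt ℓ ≤ L := by
    have h1' : Real.sqrt (ℓ' : ℝ) ≤ L := by
      rw [Real.sqrt_le_left (by linarith)]
      calc (ℓ' : ℝ) ≤ L := hℓ'LR
        _ = L * 1 := (mul_one _).symm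
        _ ≤ L * L := mul_le_mul_of_nonneg_left hLR (by linarith)
        _ = L ^ 2 := (sq _).symm
    have h2' : 1 ≤ Real.sqrt (ℓ : ℝ) := by rw [Real.le_sqrt' one_pos, one_pow]; exact hℓR
    calc Real.sqrt ℓ' / Real.sqrt ℓ ≤ Real.sqrt ℓ' / 1 :=
          div_le_div_of_nonneg_left (Real.sqrt_nonneg _) one_pos h2'
      _ ≤ L := by rw [div_one]; exact h1'
  have hmDle : |mD| ≤ 8 * N₀ * L * h := by
    rw [hmD, abs_of_nonneg (by positivity)]
    calc h * β * (Real.sqrt ℓ' / Real.sqrt ℓ) ≤ h * (8 * N₀) * L := by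
          apply mul_le_mul (mul_le_mul_of_nonneg_left hβ8 hh.le) hratio (by positivity) (by positivity)
      _ = 8 * N₀ * L * h := by ring
  have hsm : |mD * ∑ n ∈ Finset.Icc 1 N, (c n - Λ n) * Nn n|
      ≤ 8 * N₀ * L * h * M * ((2 * T₀ + 3 * A') * L + (T₀ + A')) := by
    rw [abs_mul]
    have hb : (2 * T₀ + 3 * A') * X₁ + (T₀ + A') * X₂ ≤ M * ((2 * T₀ + 3 * A') * L + (T₀ + A')) := by
      have t1 : (2 * T₀ + 3 * A') * X₁ ≤ (2 * T₀ + 3 * A') * (L * M) :=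
        mul_le_mul_of_nonneg_left hX₁le (by positivity)
      have t2 : (T₀ + A') * X₂ ≤ (T₀ + A') * M := mul_le_mul_of_nonneg_left hX₂le (by positivity)
      calc (2 * T₀ + 3 * A') * X₁ + (T₀ + A') * X₂ ≤ (2 * T₀ + 3 * A') * (L * M) + (T₀ + A') * M :=
            add_le_add t1 t2
        _ = M * ((2 * T₀ + 3 * A') * L + (T₀ + A')) := by ring
    calc |mD| * |∑ n ∈ Finset.Icc 1 N, (c n - Λ n) * Nn n|
        ≤ (8 * N₀ * L * h) * (M * ((2 * T₀ + 3 * A') * L + (T₀ + A'))) :=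
          mul_le_mul hmDle (hsmooth.trans hb) (abs_nonneg _) (by positivity)
      _ = _ := by ring
  -- assemble
  have hgoal : (∑ n ∈ Finset.Icc 1 N, c n * V n) - (∑ n ∈ Finset.Icc 1 N, (Λ n : ℝ) * V n)
      - ∑ n ∈ Finset.Icc 1 N, (c n - Λ n) * (mS * D n / n + S (Nat.gcd (n * ℓ') ℓ) / n)
      = (∑ n ∈ Finset.Icc 1 N, c n * V n) - (∑ n ∈ Finset.Icc 1 N, (Λ n : ℝ) * V n)
      - ∑ n ∈ Finset.Icc 1 N, (c n - Λ n) *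
          (B 0 * (Real.sqrt ℓ / Real.sqrt ℓ') *
              (∑ k' ∈ Finset.Icc 1 ⌊1 / (4 * h) / ((n : ℝ) * ℓ')⌋₊,
                (if ℓ ∣ n * ℓ' * k' then 1 / (k' : ℝ) else 0)) / n
            + S (Nat.gcd (n * ℓ') ℓ) / n) := by
    simp only [hmS, hD, mul_div_assoc]
  rw [← hgoal, hsplit]
  exact (abs_add_le _ _).trans (by linarith [herr, hsm])

/-- **Anchor `combTypePairOfNodeBounds`** (registered sub-goal; `pair_difference_of_node_bounds` with explicit quantifiers): node → pair
summation of arbitrary per-node bounds against `c` and `Λ`. [folklore] -/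
theorem combTypePairOfNodeBounds : ∀ B : ℝ → ℝ, ∀ N₀ h A₁ T₀ : ℝ, ∀ L ℓ ℓ' M N : ℕ, ∀ c : ℕ → ℝ, (∀ x, |B x| ≤ N₀) → (∀ x, 2 < |x| → B x = 0) → (∀ x, 0 ≤ B x) → (1 ≤ L) → (1 ≤ ℓ) → (ℓ ≤ L) → (1 ≤ ℓ') → (ℓ' ≤ L) → (0 < h) → (h ≤ 1 / (32 * L)) → (1 ≤ h * M) → (∀ n, 0 ≤ c n) → (∀ N' : ℕ, 1 ≤ N' → ∑ n ∈ Finset.Icc 1 N', c n ≤ A₁ * N') → (∀ N' : ℕ, |∑ n ∈ Finset.Icc 1 N', (c n - ArithmeticFunction.vonMangoldt n) / n| ≤ T₀) → (1 ≤ N) → ∀ S err : ℕ → ℝ, (∀ n ∈ Finset.Icc 1 N, |(∑ k' ∈ Finset.Icc 1 M, (∑ k ∈ Finset.Icc 1 M, B ((Real.log ((n : ℝ) * ℓ' * k' / ℓ) - Real.log k) / h) / Real.sqrt k) / Real.sqrt k' / Real.sqrt n) - B 0 * (Real.sqrt ℓ / Real.sqrt ℓ') * (∑ k' ∈ Finset.Icc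 1 ⌊1 / (4 * h) / ((n : ℝ) * ℓ')⌋₊, (if ℓ ∣ n * ℓ' * k' then 1 / (k' : ℝ) else 0)) / n - h * (∫ v, B v * Real.exp (-(h * v) / 2)) * (Real.sqrt ℓ' / Real.sqrt ℓ) * ((min M ⌊(ℓ : ℝ) * M * Real.exp (-(2 * h)) / (ℓ' * n)⌋₊ - ⌊1 / (4 * h) / ((n : ℝ) * ℓ')⌋₊ : ℕ) : ℝ) - S (Nat.gcd (n * ℓ') ℓ) / n| ≤ err n) → |(∑ n ∈ Finset.Icc 1 N, c n * (∑ k' ∈ Finset.Icc 1 M, (∑ k ∈ Finset.Icc 1 M, B ((Real.log ((n : ℝ) * ℓ' * k' / ℓ) - Real.log k) / h) / Real.sqrt k) / Real.sqrt k' / Real.sqrt n)) - (∑ n ∈ Finset.Icc 1 N, (ArithmeticFunction.vonMangoldt n : ℝ) * (∑ k' ∈ Finset.Icc 1 M, (∑ k ∈ Finset.Icc 1 M, B ((Real.log ((n : ℝ) * ℓ' * k' / ℓ) - Real.log k) / h) / Real.sqrt k) / Real.sqrt k' / Real.sqrt n)) - ∑ n ∈ Finset.Icc 1 N, (c n - ArithmeticFunction.vonMangoldt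 n) * (B 0 * (Real.sqrt ℓ / Real.sqrt ℓ') * (∑ k' ∈ Finset.Icc 1 ⌊1 / (4 * h) / ((n : ℝ) * ℓ')⌋₊, (if ℓ ∣ n * ℓ' * k' then 1 / (k' : ℝ) else 0)) / n + S (Nat.gcd (n * ℓ') ℓ) / n)| ≤ (∑ n ∈ Finset.Icc 1 N, (c n + ArithmeticFunction.vonMangoldt n) * err n) + 8 * N₀ * L * h * M * ((2 * T₀ + 3 * (A₁ + (Real.log 4 + 4))) * L + (T₀ + (A₁ + (Real.log 4 + 4)))) :=
  fun _ _ _ _ _ _ _ _ _ _ _ h0 hBs hB0 hL hℓ hℓL hℓ' hℓ'L hh hhL hhM hc0 hA₁ hT hN S err hnode =>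
    pair_difference_of_node_bounds h0 hBs hB0 hL hℓ hℓL hℓ' hℓ'L hh hhL hhM hc0 hA₁ hT hN S err hnode

end CombType

end Summit.RiemannHypothesis.RiemannHypothesis.Theorems.SignConeConeMagnification

end
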